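import Mathlib.Analysis.Complex.Schwarz
import Literature.Analysis.Complex.LogDerivZeros
import Literature.Analysis.Complex.SchurFunctionTaylorCoefficients
import HarnessLib

/-!
# The Schwarz lemma for a self-map of the disc omitting one value

`Literature/Analysis/Complex/PuncturedDiscSchwarz.lean` — PROOF-ONLY (no definition, no named fact).

**Theorem** (Schwarz–Pick lemma for the once-punctured disc; e.g. the value at the base point of the
hyperbolic density of `𝔻 ∖ {p}`, cf. L. V. Ahlfors, *Conformal Invariants* (1973), §1-6, and the
"punctured-disc Landau theorem"). Let `ω : 𝔻 → 𝔻` be holomorphic with `ω(0) = 0`, and suppose that `ω`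
omits a value `p ∈ 𝔻 ∖ {0}`. Then
`‖ω′(0)‖ ≤ 2 |p| log(1/|p|) / (1 − |p|²)`   (`< 1`: the universal covering of `𝔻 ∖ {p}` based at `0`
is extremal).

Proof (elementary): `h = φ_p ∘ ω`, `φ_p(w) = (p − w)/(1 − p̄ w)`, is a zero-free holomorphic self-map of
the disc with `h(0) = p`, hence `h = p · e^{G}` with `G` holomorphic, `G(0) = 0` and `Re G < log(1/|p|)`
(tree: `Literature.Analysis.Complex.exists_log_on_ball`); the Schwarz lemma for the map
`G/(2L − G) : 𝔻 → 𝔻`, `L = log(1/|p|)`, gives `|G′(0)| ≤ 2L`; and `h′(0) = −(1 − |p|²) ω′(0) = p G′(0)`.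

§2 gives the same bound for the LEADING COEFFICIENT of a self-map vanishing to order `N` at the
origin (`ω(t) = tᴺ q(t)` ⇒ `|q(0)| ≤ 2|p|log(1/|p|)/(1 − |p|²)`), via the tree's order-`N` Schwarz lemma
(`norm_le_one_of_eq_pow_mul`, `SchurFunctionTaylorCoefficients.lean`) — the form consumed by the
symmetrization step.

This is brick B1 of the elementary route to the conformal radius of `ℂ ∖ μ_N` (CDT Thm 5.1.4, lower
bound) recorded in `Summits/…/Cruxes/StarredOptimalManinUnitFiveSeven/Lines/cdt_thm1-radius-elementary-route-g39.md`.

## References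
* [Ahlfors1973] L. V. Ahlfors, *Conformal invariants: topics in geometric function theory*,
  McGraw-Hill 1973, §1-6 (hyperbolic metric of the punctured disc).
* [CalegariDimitrovTang2025] F. Calegari, V. Dimitrov, Y. Tang, J. Amer. Math. Soc. 38 (2025),
  Theorem 5.1.4 (consumer).
-/

noncomputable section

open Set Metric Filter Real
open scoped Topology ComplexConjugate

namespace Literature.Analysis.Complex

open _root_.Complex

/-- The Möbius numerator/denominator identity `|1 − p̄ w|² − |p − w|² = (1 − |p|²)(1 − |w|²)`.
[cite: Beardon1983, Thm. 7.2.1] -/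
private theorem normSq_one_sub_conj_mul_sub_normSq_sub' (p w : ℂ) :
    Complex.normSq (1 - conj p * w) - Complex.normSq (p - w) =
      (1 - Complex.normSq p) * (1 - Complex.normSq w) := by
  simp only [Complex.normSq_apply, Complex.sub_re, Complex.sub_im, Complex.one_re, Complex.one_im,
    Complex.mul_re, Complex.mul_im, Complex.conj_re, Complex.conj_im]
  ring

/-- For `|p| < 1` and `|w| < 1`: `1 − p̄ w ≠ 0`. [cite: Beardon1983, Thm. 7.2.1] -/
private theorem one_sub_conj_mul_ne_zero' {p w : ℂ} (hp : ‖p‖ < 1) (hw : ‖w‖ < 1) : 1 - conj p * w ≠ 0 := by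
  intro h
  have h1 : ‖conj p * w‖ = 1 := by
    rw [sub_eq_zero] at h
    rw [← h, norm_one]
  rw [norm_mul, Complex.norm_conj] at h1
  nlinarith [norm_nonneg p, norm_nonneg w]

/-- For `|p| < 1` and `|w| < 1`: `|(p − w)/(1 − p̄ w)| < 1` (the Möbius involution `φ_p` maps the disc
into itself). [cite: Beardon1983, Thm. 7.2.1] -/
private theorem norm_moebius_lt_one' {p w : ℂ} (hp : ‖p‖ < 1) (hw : ‖w‖ < 1) :
    ‖(p - w) / (1 - conj p * w)‖ < 1 := by
  have hden := one_sub_conj_mul_ne_zero' hp hw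
  rw [norm_div, div_lt_one (norm_pos_iff.mpr hden)]
  have hsq : ‖p - w‖ ^ 2 < ‖1 - conj p * w‖ ^ 2 := by
    rw [← Complex.normSq_eq_norm_sq, ← Complex.normSq_eq_norm_sq]
    have h := normSq_one_sub_conj_mul_sub_normSq_sub' p w
    have hp2 : Complex.normSq p < 1 := by
      rw [Complex.normSq_eq_norm_sq]; nlinarith [norm_nonneg p]
    have hw2 : Complex.normSq w < 1 := by
      rw [Complex.normSq_eq_norm_sq]; nlinarith [norm_nonneg w]
    nlinarith
  exact lt_of_pow_lt_pow_left₀ 2 (norm_nonneg _) hsq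

/-- **Schwarz lemma for maps into a half-plane.** If `G` is holomorphic on the unit disc, `G(0) = 0`
and `Re G < L` on the disc, then `‖G′(0)‖ ≤ 2L` (apply the Schwarz lemma to `G/(2L − G) : 𝔻 → 𝔻`;
the Schwarz–Pick lemma for the half-plane `{Re < L}` at the point `0`). [cite: Ahlfors1973, §1-1 and §1-2] -/
theorem norm_deriv_le_two_mul_of_re_lt {G : ℂ → ℂ} (hG : DifferentiableOn ℂ G (ball (0 : ℂ) 1))
    (hG0 : G 0 = 0) {L : ℝ} (hL : ∀ z ∈ ball (0 : ℂ) 1, (G z).re < L) : ‖deriv G 0‖ ≤ 2 * L := by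
  have hLpos : 0 < L := by simpa [hG0] using hL 0 (mem_ball_self one_pos)
  -- the Cayley-type map `ψ = G / (2L − G)` is a self-map of the disc fixing `0`
  have hden : ∀ z ∈ ball (0 : ℂ) 1, (2 * L : ℂ) - G z ≠ 0 := by
    intro z hz h
    have := congrArg Complex.re h
    simp only [Complex.sub_re, Complex.mul_re, Complex.re_ofNat, Complex.ofReal_re, Complex.im_ofNat,
      Complex.ofReal_im, mul_zero, sub_zero, Complex.zero_re] at this
    linarith [hL z hz]
  set ψ : ℂ → ℂ := fun z ↦ G z / ((2 * L : ℂ) - G z) with hψ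
  have hψd : DifferentiableOn ℂ ψ (ball (0 : ℂ) 1) :=
    hG.div ((differentiableOn_const _).sub hG) hden
  have hψ0 : ψ 0 = 0 := by simp [hψ, hG0]
  have hψmaps : MapsTo ψ (ball (0 : ℂ) 1) (closedBall (ψ 0) 1) := by
    intro z hz
    rw [hψ0, mem_closedBall, dist_zero_right, hψ]
    change ‖G z / ((2 * L : ℂ) - G z)‖ ≤ 1
    rw [norm_div, div_le_one (norm_pos_iff.mpr (hden z hz))]
    -- `|G| ≤ |2L − G|` since `Re G < L`
    have hsq : ‖G z‖ ^ 2 ≤ ‖(2 * L : ℂ) - G z‖ ^ 2 := by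
      rw [← Complex.normSq_eq_norm_sq, ← Complex.normSq_eq_norm_sq, Complex.normSq_apply,
        Complex.normSq_apply]
      simp only [Complex.sub_re, Complex.sub_im, Complex.mul_re, Complex.mul_im, Complex.re_ofNat,
        Complex.im_ofNat, Complex.ofReal_re, Complex.ofReal_im, mul_zero, sub_zero, zero_mul,
        add_zero, zero_sub]
      nlinarith [hL z hz]
    exact le_of_pow_le_pow_left₀ two_ne_zero (norm_nonneg _) hsq
  have hS := Complex.norm_deriv_le_div_of_mapsTo_ball hψd hψmaps one_pos
  rw [div_one] at hS
  -- `ψ′(0) = G′(0)/(2L)`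
  have hG' : HasDerivAt G (deriv G 0) 0 :=
    (hG.differentiableAt (ball_mem_nhds (0 : ℂ) one_pos)).hasDerivAt
  have hD : HasDerivAt (fun z ↦ (2 * L : ℂ) - G z) (-deriv G 0) 0 := hG'.const_sub _
  have hψ' : HasDerivAt ψ (deriv G 0 / (2 * L : ℂ)) 0 := by
    have h := hG'.div hD (hden 0 (mem_ball_self one_pos))
    have hL0 : (2 * L : ℂ) ≠ 0 := by exact_mod_cast (by positivity : (2 * L : ℝ) ≠ 0)
    have heq : (deriv G 0 * ((2 * L : ℂ) - G 0) - G 0 * -deriv G 0) / ((2 * L : ℂ) - G 0) ^ 2 =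
        deriv G 0 / (2 * L : ℂ) := by
      rw [hG0, sub_zero, zero_mul, sub_zero, pow_two, mul_div_mul_right _ _ hL0]
    rw [heq] at h
    exact h
  rw [hψ'.deriv, norm_div] at hS
  have h2L : ‖(2 * L : ℂ)‖ = 2 * L := by
    rw [show (2 * L : ℂ) = ((2 * L : ℝ) : ℂ) by push_cast; ring, Complex.norm_real, Real.norm_eq_abs,
      abs_of_pos (by positivity)]
  rw [h2L, div_le_one (by positivity)] at hS
  exact hS

/-- ★ **Schwarz lemma for the once-punctured disc.** Let `ω` be holomorphic on the unit disc, with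
values in the unit disc, `ω(0) = 0`, and suppose `ω` omits the value `p`, `0 < |p| < 1`. Then
`‖ω′(0)‖ ≤ 2|p| log(1/|p|)/(1 − |p|²)`. (The bound is `< 1` and is attained by the universal covering
map of `𝔻 ∖ {p}` sending `0` to `0`; it is `1 − (1 − |p|)²/6 + O((1−|p|)³)` as `|p| → 1`.)
Proof: `h = (p − ω)/(1 − p̄ ω)` is zero-free on the disc with `h(0) = p`, so `h = p e^{G}`,
`G(0) = 0` (`exists_log_on_ball`); `|h| < 1` gives `Re G < log(1/|p|)`, so `|G′(0)| ≤ 2 log(1/|p|)`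
(`norm_deriv_le_two_mul_of_re_lt`); finally `h′(0) = −(1 − |p|²) ω′(0) = p G′(0)`.
[cite: Ahlfors1973, §1-6] -/
theorem norm_deriv_le_of_mapsTo_ball_of_forall_ne {ω : ℂ → ℂ}
    (hω : DifferentiableOn ℂ ω (ball (0 : ℂ) 1)) (hmaps : MapsTo ω (ball (0 : ℂ) 1) (ball (0 : ℂ) 1))
    (hω0 : ω 0 = 0) {p : ℂ} (hp0 : p ≠ 0) (hp1 : ‖p‖ < 1) (hne : ∀ z ∈ ball (0 : ℂ) 1, ω z ≠ p) :
    ‖deriv ω 0‖ ≤ 2 * ‖p‖ * Real.log ‖p‖⁻¹ / (1 - ‖p‖ ^ 2) := by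
  have hp_pos : 0 < ‖p‖ := norm_pos_iff.mpr hp0
  have h1p : 0 < 1 - ‖p‖ ^ 2 := by nlinarith
  have hωlt : ∀ z ∈ ball (0 : ℂ) 1, ‖ω z‖ < 1 := fun z hz ↦ by
    simpa [mem_ball, dist_zero_right] using hmaps hz
  -- `h = φ_p ∘ ω`
  set h : ℂ → ℂ := fun z ↦ (p - ω z) / (1 - conj p * ω z) with hh
  have hden : ∀ z ∈ ball (0 : ℂ) 1, 1 - conj p * ω z ≠ 0 := fun z hz ↦
    one_sub_conj_mul_ne_zero' hp1 (hωlt z hz)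
  have hhd : DifferentiableOn ℂ h (ball (0 : ℂ) 1) :=
    ((differentiableOn_const _).sub hω).div ((differentiableOn_const _).sub
      ((differentiableOn_const _).mul hω)) hden
  have hh0 : h 0 = p := by simp [hh, hω0]
  have hhne : ∀ z ∈ ball (0 : ℂ) 1, h z ≠ 0 := by
    intro z hz hz0
    rw [hh, div_eq_zero_iff] at hz0
    rcases hz0 with h1 | h1
    · exact hne z hz (sub_eq_zero.mp h1).symm
    · exact hden z hz h1
  have hhlt : ∀ z ∈ ball (0 : ℂ) 1, ‖h z‖ < 1 := fun z hz ↦ norm_moebius_lt_one' hp1 (hωlt z hz)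
  -- holomorphic logarithm `h = p · exp G`, `G 0 = 0`
  obtain ⟨G, hGd, hG0, hG', hGexp⟩ := exists_log_on_ball hhd hhne
  rw [hh0] at hGexp
  have hRe : ∀ z ∈ ball (0 : ℂ) 1, (G z).re < Real.log ‖p‖⁻¹ := by
    intro z hz
    have h1 : ‖h z‖ = ‖p‖ * Real.exp (G z).re := by
      rw [hGexp z hz, norm_mul, Complex.norm_exp]
    have h2 : ‖p‖ * Real.exp (G z).re < 1 := h1 ▸ hhlt z hz
    have h3 : Real.exp (G z).re < ‖p‖⁻¹ := by
      rw [lt_inv_comm₀ (Real.exp_pos _) hp_pos, ← one_div, lt_div_iff₀ (Real.exp_pos _)]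
      linarith [h2, mul_comm ‖p‖ (Real.exp (G z).re)]
    calc (G z).re = Real.log (Real.exp (G z).re) := (Real.log_exp _).symm
      _ < Real.log ‖p‖⁻¹ := Real.log_lt_log (Real.exp_pos _) h3
  have hGbound : ‖deriv G 0‖ ≤ 2 * Real.log ‖p‖⁻¹ := norm_deriv_le_two_mul_of_re_lt hGd hG0 hRe
  -- `h′(0)` two ways
  have hω' : HasDerivAt ω (deriv ω 0) 0 :=
    (hω.differentiableAt (ball_mem_nhds (0 : ℂ) one_pos)).hasDerivAt
  have hnum : HasDerivAt (fun z ↦ p - ω z) (-deriv ω 0) 0 := hω'.const_sub p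
  have hdenD : HasDerivAt (fun z ↦ 1 - conj p * ω z) (-(conj p * deriv ω 0)) 0 :=
    (hω'.const_mul (conj p)).const_sub 1
  have hh' : HasDerivAt h (-(1 - conj p * p) * deriv ω 0) 0 := by
    have hq := hnum.div hdenD (hden 0 (mem_ball_self one_pos))
    have heq : (-deriv ω 0 * (1 - conj p * ω 0) - (p - ω 0) * -(conj p * deriv ω 0)) /
        (1 - conj p * ω 0) ^ 2 = -(1 - conj p * p) * deriv ω 0 := by
      rw [hω0, mul_zero, sub_zero, sub_zero, one_pow, div_one]
      ring
    rw [heq] at hq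
    exact hq
  have hh'' : HasDerivAt h (p * deriv G 0) 0 := by
    have hG0' : HasDerivAt G (deriv G 0) 0 :=
      (hGd.differentiableAt (ball_mem_nhds (0 : ℂ) one_pos)).hasDerivAt
    have hE : HasDerivAt (fun z ↦ p * Complex.exp (G z)) (p * (Complex.exp (G 0) * deriv G 0)) 0 :=
      (hG0'.cexp).const_mul p
    rw [hG0, Complex.exp_zero, one_mul] at hE
    refine hE.congr_of_eventuallyEq ?_
    filter_upwards [ball_mem_nhds (0 : ℂ) one_pos] with z hz
    exact hGexp z hz
  have heq : -(1 - conj p * p) * deriv ω 0 = p * deriv G 0 := hh'.unique hh''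
  have hpp : conj p * p = ((‖p‖ ^ 2 : ℝ) : ℂ) := by
    rw [Complex.conj_mul', Complex.ofReal_pow]
  have hnorm : (1 - ‖p‖ ^ 2) * ‖deriv ω 0‖ = ‖p‖ * ‖deriv G 0‖ := by
    have := congrArg norm heq
    rw [norm_mul, norm_mul, norm_neg, hpp, ← Complex.ofReal_one, ← Complex.ofReal_sub,
      Complex.norm_real, Real.norm_eq_abs, abs_of_pos h1p] at this
    exact this
  -- conclude
  rw [le_div_iff₀ h1p]
  calc ‖deriv ω 0‖ * (1 - ‖p‖ ^ 2) = ‖p‖ * ‖deriv G 0‖ := by rw [mul_comm]; exact hnorm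
    _ ≤ ‖p‖ * (2 * Real.log ‖p‖⁻¹) := mul_le_mul_of_nonneg_left hGbound hp_pos.le
    _ = 2 * ‖p‖ * Real.log ‖p‖⁻¹ := by ring

/-! ### §2 The same for maps vanishing to order `N` at the origin -/

/-- The entire function `E(w) = (eʷ − 1)/w` (`E(0) = 1`), as `dslope exp 0`; `eʷ − 1 = w · E(w)`.
[cite: Ahlfors1973, §1-1] -/
theorem exp_sub_one_eq_mul_dslope (w : ℂ) : Complex.exp w - 1 = w * dslope Complex.exp 0 w := by
  rcases eq_or_ne w 0 with rfl | hw
  · simp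
  · rw [dslope_of_ne _ hw, slope_def_field, Complex.exp_zero, sub_zero, mul_div_cancel₀ _ hw]

/-- ★ **Punctured-disc Schwarz lemma at order `N`.** Let `ω = tᴺ · q` on the unit disc (`q`
holomorphic, `N ≥ 1`), with `ω(𝔻) ⊆ 𝔻` omitting the value `p`, `0 < |p| < 1`. Then the leading
coefficient obeys `‖q(0)‖ ≤ 2|p| log(1/|p|)/(1 − |p|²)`. (For `N = 1` this is
`norm_deriv_le_of_mapsTo_ball_of_forall_ne`.) Proof: as in §1, `h = φ_p ∘ ω = p e^{G}`,
`Re G < L = log(1/|p|)`; from `e^{G} − 1 = −tᴺ q (1 − |p|²)/(p(1 − p̄ ω))` the function `G/tᴺ` is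
holomorphic with value `−q(0)(1−|p|²)/p` at `0` (`e^G − 1 = G · E(G)`, `E(0) = 1`), and the
order-`N` Schwarz lemma for `G/(2L − G)` gives `|G/tᴺ|(0) ≤ 2L`. [cite: Ahlfors1973, §1-6] -/
theorem norm_le_of_mapsTo_ball_of_forall_ne_of_eq_pow_mul {ω q : ℂ → ℂ} {N : ℕ} (hN : 1 ≤ N)
    (hω : DifferentiableOn ℂ ω (ball (0 : ℂ) 1)) (hq : DifferentiableOn ℂ q (ball (0 : ℂ) 1))
    (hfac : ∀ z ∈ ball (0 : ℂ) 1, ω z = z ^ N * q z)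
    (hmaps : MapsTo ω (ball (0 : ℂ) 1) (ball (0 : ℂ) 1))
    {p : ℂ} (hp0 : p ≠ 0) (hp1 : ‖p‖ < 1) (hne : ∀ z ∈ ball (0 : ℂ) 1, ω z ≠ p) :
    ‖q 0‖ ≤ 2 * ‖p‖ * Real.log ‖p‖⁻¹ / (1 - ‖p‖ ^ 2) := by
  have hp_pos : 0 < ‖p‖ := norm_pos_iff.mpr hp0
  have h1p : 0 < 1 - ‖p‖ ^ 2 := by nlinarith
  have hb0 : (0 : ℂ) ∈ ball (0 : ℂ) 1 := mem_ball_self one_pos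
  have hω0 : ω 0 = 0 := by rw [hfac 0 hb0, zero_pow (by omega), zero_mul]
  have hωlt : ∀ z ∈ ball (0 : ℂ) 1, ‖ω z‖ < 1 := fun z hz ↦ by
    simpa [mem_ball, dist_zero_right] using hmaps hz
  -- `h = φ_p ∘ ω = p · exp G`
  set h : ℂ → ℂ := fun z ↦ (p - ω z) / (1 - conj p * ω z) with hh
  have hden : ∀ z ∈ ball (0 : ℂ) 1, 1 - conj p * ω z ≠ 0 := fun z hz ↦
    one_sub_conj_mul_ne_zero' hp1 (hωlt z hz)
  have hhd : DifferentiableOn ℂ h (ball (0 : ℂ) 1) :=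
    ((differentiableOn_const _).sub hω).div ((differentiableOn_const _).sub
      ((differentiableOn_const _).mul hω)) hden
  have hh0 : h 0 = p := by simp [hh, hω0]
  have hhne : ∀ z ∈ ball (0 : ℂ) 1, h z ≠ 0 := by
    intro z hz hz0
    rw [hh, div_eq_zero_iff] at hz0
    rcases hz0 with h1 | h1
    · exact hne z hz (sub_eq_zero.mp h1).symm
    · exact hden z hz h1
  have hhlt : ∀ z ∈ ball (0 : ℂ) 1, ‖h z‖ < 1 := fun z hz ↦ norm_moebius_lt_one' hp1 (hωlt z hz)
  obtain ⟨G, hGd, hG0, -, hGexp⟩ := exists_log_on_ball hhd hhne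
  rw [hh0] at hGexp
  set L : ℝ := Real.log ‖p‖⁻¹ with hL
  have hRe : ∀ z ∈ ball (0 : ℂ) 1, (G z).re < L := by
    intro z hz
    have h1 : ‖h z‖ = ‖p‖ * Real.exp (G z).re := by
      rw [hGexp z hz, norm_mul, Complex.norm_exp]
    have h2 : ‖p‖ * Real.exp (G z).re < 1 := h1 ▸ hhlt z hz
    have h3 : Real.exp (G z).re < ‖p‖⁻¹ := by
      rw [lt_inv_comm₀ (Real.exp_pos _) hp_pos, ← one_div, lt_div_iff₀ (Real.exp_pos _)]
      linarith [h2, mul_comm ‖p‖ (Real.exp (G z).re)]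
    calc (G z).re = Real.log (Real.exp (G z).re) := (Real.log_exp _).symm
      _ < L := Real.log_lt_log (Real.exp_pos _) h3
  have hLpos : 0 < L := by simpa [hG0] using hRe 0 hb0
  -- `e^{G} − 1 = tᴺ · M`, `M` holomorphic, `M 0 = −q(0)(1−|p|²)/p`
  set M : ℂ → ℂ := fun z ↦ -(q z * (1 - conj p * p)) / (p * (1 - conj p * ω z)) with hM
  have hMd : DifferentiableOn ℂ M (ball (0 : ℂ) 1) :=
    ((hq.mul_const _).neg).div ((differentiableOn_const _).mul
      ((differentiableOn_const _).sub ((differentiableOn_const _).mul hω)))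
      (fun z hz ↦ mul_ne_zero hp0 (hden z hz))
  have hEq : ∀ z ∈ ball (0 : ℂ) 1, Complex.exp (G z) - 1 = z ^ N * M z := by
    intro z hz
    have h1 : Complex.exp (G z) = h z / p := by
      rw [hGexp z hz, mul_div_cancel_left₀ _ hp0]
    have h2 : h z - p = -(ω z * (1 - conj p * p)) / (1 - conj p * ω z) := by
      rw [hh, eq_div_iff (hden z hz)]
      simp only
      rw [sub_mul, div_mul_cancel₀ _ (hden z hz)]
      ring
    have h3 : Complex.exp (G z) - 1 = (h z - p) / p := by
      rw [h1, sub_div, div_self hp0]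
    have hden' : 1 - conj p * (z ^ N * q z) ≠ 0 := by rw [← hfac z hz]; exact hden z hz
    rw [h3, h2, hM]
    simp only
    rw [hfac z hz]
    field_simp
  -- `G = tᴺ · n` with `n` holomorphic: `n = M / E(G)` near `0`, `n = G/tᴺ` off `0`
  set E : ℂ → ℂ := dslope Complex.exp 0 with hE
  have hEd : Differentiable ℂ E := by
    have : DifferentiableOn ℂ E univ :=
      (Complex.differentiableOn_dslope (Filter.univ_mem)).mpr Complex.differentiable_exp.differentiableOn
    exact differentiableOn_univ.mp this
  have hE0 : E 0 = 1 := by rw [hE, dslope_same, Complex.deriv_exp, Complex.exp_zero]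
  have hGE : ∀ z ∈ ball (0 : ℂ) 1, G z * E (G z) = z ^ N * M z := fun z hz ↦ by
    rw [← hEq z hz, exp_sub_one_eq_mul_dslope]
  set n : ℂ → ℂ := fun z ↦ if z = 0 then M 0 else G z / z ^ N with hn
  have hn_off : ∀ z, z ≠ 0 → n z = G z / z ^ N := fun z hz ↦ by simp [hn, hz]
  have hfacG : ∀ z ∈ ball (0 : ℂ) 1, G z = z ^ N * n z := by
    intro z hz
    rcases eq_or_ne z 0 with rfl | hz0
    · rw [hG0, zero_pow (by omega), zero_mul]
    · rw [hn_off z hz0, mul_div_cancel₀ _ (pow_ne_zero _ hz0)]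
  -- near `0`, `E (G z) ≠ 0` and `n = M / (E ∘ G)`
  have hEG : ContinuousAt (fun z ↦ E (G z)) 0 :=
    hEd.continuous.continuousAt.comp (hGd.continuousOn.continuousAt (ball_mem_nhds _ one_pos))
  have hEGne : ∀ᶠ z in 𝓝 (0 : ℂ), E (G z) ≠ 0 := by
    apply hEG.eventually_ne
    rw [hG0, hE0]; exact one_ne_zero
  have hn_near : n =ᶠ[𝓝 0] fun z ↦ M z / E (G z) := by
    filter_upwards [hEGne, ball_mem_nhds (0 : ℂ) one_pos] with z hz hzb
    rcases eq_or_ne z 0 with rfl | hz0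
    · simp [hn, hG0, hE0]
    · rw [hn_off z hz0]
      have hzN : z ^ N ≠ 0 := pow_ne_zero _ hz0
      rw [div_eq_div_iff hzN hz, hGE z hzb, mul_comm]
  have hnd : DifferentiableOn ℂ n (ball (0 : ℂ) 1) := by
    intro z hz
    rcases eq_or_ne z 0 with rfl | hz0
    · have hd0 : DifferentiableAt ℂ (fun z ↦ M z / E (G z)) 0 :=
        ((hMd.differentiableAt (ball_mem_nhds _ one_pos)).div
          ((hEd.differentiableAt).comp 0 (hGd.differentiableAt (ball_mem_nhds _ one_pos)))
          (by rw [hG0, hE0]; exact one_ne_zero))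
      exact (hn_near.differentiableAt_iff.mpr hd0).differentiableWithinAt
    · have : DifferentiableAt ℂ (fun w ↦ G w / w ^ N) z :=
        (hGd.differentiableAt (isOpen_ball.mem_nhds hz)).div
          ((differentiableAt_id.pow N)) (pow_ne_zero _ hz0)
      refine (this.congr_of_eventuallyEq ?_).differentiableWithinAt
      filter_upwards [isOpen_ne.mem_nhds hz0] with w hw using hn_off w hw
  have hn0 : n 0 = M 0 := by simp [hn]
  -- `ψ = G/(2L − G) = tᴺ · Ψ`, a self-map of the closed disc
  have hden2 : ∀ z ∈ ball (0 : ℂ) 1, (2 * L : ℂ) - G z ≠ 0 := by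
    intro z hz hzero
    have := congrArg Complex.re hzero
    simp only [Complex.sub_re, Complex.mul_re, Complex.re_ofNat, Complex.ofReal_re, Complex.im_ofNat,
      Complex.ofReal_im, mul_zero, sub_zero, Complex.zero_re] at this
    linarith [hRe z hz]
  have hψ1 : ∀ z ∈ ball (0 : ℂ) 1, ‖G z / ((2 * L : ℂ) - G z)‖ ≤ 1 := by
    intro z hz
    rw [norm_div, div_le_one (norm_pos_iff.mpr (hden2 z hz))]
    have hsq : ‖G z‖ ^ 2 ≤ ‖(2 * L : ℂ) - G z‖ ^ 2 := by
      rw [← Complex.normSq_eq_norm_sq, ← Complex.normSq_eq_norm_sq, Complex.normSq_apply,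
        Complex.normSq_apply]
      simp only [Complex.sub_re, Complex.sub_im, Complex.mul_re, Complex.mul_im, Complex.re_ofNat,
        Complex.im_ofNat, Complex.ofReal_re, Complex.ofReal_im, mul_zero, sub_zero, zero_mul,
        add_zero, zero_sub]
      nlinarith [hRe z hz]
    exact le_of_pow_le_pow_left₀ two_ne_zero (norm_nonneg _) hsq
  have hΨd : DifferentiableOn ℂ (fun z ↦ n z / ((2 * L : ℂ) - G z)) (ball (0 : ℂ) 1) :=
    hnd.div ((differentiableOn_const _).sub hGd) hden2
  have hfacψ : ∀ z ∈ ball (0 : ℂ) 1,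
      G z / ((2 * L : ℂ) - G z) = z ^ N * (n z / ((2 * L : ℂ) - G z)) := by
    intro z hz
    rw [hfacG z hz, mul_div_assoc]
  have hS := norm_le_one_of_eq_pow_mul hN hΨd hψ1 hfacψ
  -- unwind: `‖n 0‖ ≤ 2L`, `n 0 = M 0 = −q(0)(1 − |p|²)/p`
  rw [hG0, sub_zero, norm_div, hn0] at hS
  have h2L : ‖(2 * L : ℂ)‖ = 2 * L := by
    rw [show (2 * L : ℂ) = ((2 * L : ℝ) : ℂ) by push_cast; ring, Complex.norm_real, Real.norm_eq_abs,
      abs_of_pos (by positivity)]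
  rw [h2L, div_le_one (by positivity)] at hS
  have hpp : conj p * p = ((‖p‖ ^ 2 : ℝ) : ℂ) := by rw [Complex.conj_mul', Complex.ofReal_pow]
  have hM0 : ‖M 0‖ = ‖q 0‖ * (1 - ‖p‖ ^ 2) / ‖p‖ := by
    simp only [hM, hω0, mul_zero, sub_zero, mul_one, norm_div, norm_neg, norm_mul, hpp]
    rw [← Complex.ofReal_one, ← Complex.ofReal_sub, Complex.norm_real, Real.norm_eq_abs,
      abs_of_pos h1p]
  rw [hM0, div_le_iff₀ hp_pos] at hS
  rw [le_div_iff₀ h1p]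
  calc ‖q 0‖ * (1 - ‖p‖ ^ 2) ≤ 2 * L * ‖p‖ := hS
    _ = 2 * ‖p‖ * Real.log ‖p‖⁻¹ := by rw [hL]; ring

end Literature.Analysis.Complex

end
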